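import Mathlib
import HarnessLib
import Summits.KontsevichZagierPeriods.Zeta5Search.VWPBarnesWeighted

/-!
# ζ(5) search — the Barnes-integral representation of Zudilin's very-well-poised series `F_m` (cell `pub-zeta5`, ct-1 g28)

HONEST FRAMING: systematic search; no irrationality claim unless kernel-certified.  An identity of special functions (Mellin–Barnes
integral = very-well-poised hypergeometric series at unit argument); nothing here is an irrationality result, a worthiness exponent
or a denominator statement; no named fact is discharged; no definition is introduced.

Brick B4 of `HOME/ct-1/g27/VWP-BLUEPRINT-g27.md` — COMPLETE.  For `h : ℕ → ℂ` with `0 < s₁ < Re h_j` (`j ≤ m`),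
`s₁ < Re(1 + h₀ − h_{j+1})` (`j < m`) and Zudilin's (5) `2 Σ_{j=1}^m Re h_j < (m−1)(1 + Re h₀)`, on the line `s = −s₁ + iy`:

  `(1/2π) ∫ (h₀+2s) ∏_{j≤m}Γ(h_j+s) Γ(−s) / ∏_{j<m}Γ(1+h₀−h_{j+1}+s) · e^{iεπs} dy
      = Σ_μ (h₀+2μ) ∏_{j=0}^{m} Γ(h_j+μ)/Γ(1+h₀−h_j+μ) · (−1)^μ e^{iεπμ}`          (`barnes_eq_tsum`, any `|ε| ≤ 1`),

and, with Zudilin's parity rule `ε = 0` & `m` even / `ε = ±1` & `m` odd, the right-hand side is EXACTLY the inline very-well-poised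
series `F_m(h₀;h₁,…,h_m) = Σ_μ (h₀+2μ) ∏ Γ(h_j+μ)/Γ(1+h₀−h_j+μ) (−1)^{(m+1)μ}` of `VWPSeriesSummable` (`barnes_eq_vwpSeries`)
[Zudilin math/0206177, (1) and §2; Nesterenko 2003, Lemma 3].  Obtained from the weighted identity `VWPBarnesWeighted.barnes_weighted_eq_tsum`
by letting the Abel weight `w → 1⁻`: dominated convergence on the integral side (majorant `‖V‖e^{π|y|}2^{s₁}`, integrable exactly
under (5) by `VWPBarnesKernel.integrable_norm_vwpKernel_mul_exp_pi`) and Tannery's theorem on the series side (majorant the `F_m`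
terms, `VWPSeriesSummable.summable_vwpTerm`).

Theorems only; imports `Zeta5Search/VWPBarnesWeighted`.
-/

noncomputable section

namespace Summit.KontsevichZagierPeriods.Zeta5Search.VWPBarnesSeries

open MeasureTheory Set Filter
open scoped Real Topology
open Summit.KontsevichZagierPeriods.Zeta5Search.VWPBarnesShift (norm_phase_le norm_weight_eq continuous_integrand_line)
open Summit.KontsevichZagierPeriods.Zeta5Search.VWPBarnesKernel (integrable_norm_vwpKernel_mul_exp_pi)
open Summit.KontsevichZagierPeriods.Zeta5Search.VWPBarnesWeighted (barnes_weighted_eq_tsum norm_phase_nat den_pos_all)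
open Summit.KontsevichZagierPeriods.Zeta5Search.VWPSeriesSummable (summable_vwpTerm)
open Summit.KontsevichZagierPeriods.Zeta5Search.VWPSeriesTerms (phase_parity)

variable {m : ℕ} {h : ℕ → ℂ} {s₁ ε : ℝ}

/-! ### 1. The two limits `w → 1⁻` -/

/-- `w ↦ w^s` (real `w`, complex `s`) tends to `1` as `w → 1⁻`. -/
theorem tendsto_weight_one (s : ℂ) : Tendsto (fun w : ℝ => (w : ℂ) ^ s) (𝓝[<] 1) (𝓝 1) := by
  have hc : ContinuousAt (fun w : ℝ => (w : ℂ) ^ s) 1 := Complex.continuousAt_ofReal_cpow_const 1 s (Or.inr one_ne_zero)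
  have := hc.tendsto
  simp only [Complex.ofReal_one, Complex.one_cpow] at this
  exact this.mono_left nhdsWithin_le_nhds

/-- **The integral side**: `(1/2π)∫ V e^{iεπs} w^s dy → (1/2π)∫ V e^{iεπs} dy` as `w → 1⁻` (dominated convergence; majorant
`‖V‖e^{π|y|}2^{s₁}` for `w ≥ ½`, integrable under (5)). -/
theorem tendsto_integral_weight (m : ℕ) (h : ℕ → ℂ) (hs₁ : 0 < s₁) (hnum : ∀ j, j ≤ m → s₁ < (h j).re)
    (hden : ∀ j, j < m → s₁ < (1 + h 0 - h (j + 1)).re)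
    (h5 : 2 * (∑ j ∈ Finset.range m, (h (j + 1)).re) < ((m : ℝ) - 1) * (1 + (h 0).re)) (hε : |ε| ≤ 1) :
    Tendsto (fun w : ℝ => ∫ y : ℝ,
        (h 0 + 2 * (-(s₁ : ℂ) + (y : ℂ) * Complex.I)) *
                (∏ j ∈ Finset.range (m + 1), Complex.Gamma (h j + (-(s₁ : ℂ) + (y : ℂ) * Complex.I))) *
                Complex.Gamma (-(-(s₁ : ℂ) + (y : ℂ) * Complex.I)) /
              (∏ j ∈ Finset.range m, Complex.Gamma (1 + h 0 - h (j + 1) + (-(s₁ : ℂ) + (y : ℂ) * Complex.I))) *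
            Complex.exp (ε * π * Complex.I * (-(s₁ : ℂ) + (y : ℂ) * Complex.I)) *
          (w : ℂ) ^ (-(s₁ : ℂ) + (y : ℂ) * Complex.I)) (𝓝[<] 1)
      (𝓝 (∫ y : ℝ,
        (h 0 + 2 * (-(s₁ : ℂ) + (y : ℂ) * Complex.I)) *
                (∏ j ∈ Finset.range (m + 1), Complex.Gamma (h j + (-(s₁ : ℂ) + (y : ℂ) * Complex.I))) *
                Complex.Gamma (-(-(s₁ : ℂ) + (y : ℂ) * Complex.I)) /
              (∏ j ∈ Finset.range m, Complex.Gamma (1 + h 0 - h (j + 1) + (-(s₁ : ℂ) + (y : ℂ) * Complex.I))) *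
            Complex.exp (ε * π * Complex.I * (-(s₁ : ℂ) + (y : ℂ) * Complex.I)))) := by
  have hIoo : Ioo (1 / 2 : ℝ) 1 ∈ 𝓝[<] (1 : ℝ) := Ioo_mem_nhdsLT (by norm_num)
  have hline : ∀ y : ℝ, (((-s₁ : ℝ) : ℂ) + (y : ℂ) * Complex.I) = -(s₁ : ℂ) + (y : ℂ) * Complex.I := fun y => by push_cast; ring
  have hanat : ∀ n : ℕ, (-s₁ : ℝ) ≠ n := fun n han => by linarith [n.cast_nonneg (α := ℝ)]
  have hnum' : ∀ j, j ≤ m → -(h j).re < -s₁ := fun j hj => by linarith [hnum j hj]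
  have hden' : ∀ j, j < m → -(1 + h 0 - h (j + 1)).re < -s₁ := fun j hj => by linarith [hden j hj]
  refine tendsto_integral_filter_of_dominated_convergence
    (fun y => ‖(h 0 + 2 * (-(s₁ : ℂ) + (y : ℂ) * Complex.I)) *
            (∏ j ∈ Finset.range (m + 1), Complex.Gamma (h j + (-(s₁ : ℂ) + (y : ℂ) * Complex.I))) *
            Complex.Gamma (-(-(s₁ : ℂ) + (y : ℂ) * Complex.I)) /
          ∏ j ∈ Finset.range m, Complex.Gamma (1 + h 0 - h (j + 1) + (-(s₁ : ℂ) + (y : ℂ) * Complex.I))‖ *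
        Real.exp (π * |y|) * (2 : ℝ) ^ s₁) ?_ ?_ ?_ ?_
  · -- measurability, for `w > 0`
    filter_upwards [hIoo] with w hw
    have := (continuous_integrand_line m h ε (by linarith [hw.1] : 0 < w) hanat hnum' hden').aestronglyMeasurable (μ := volume)
    simpa only [hline] using this
  · -- the bound, for `½ < w < 1`
    filter_upwards [hIoo] with w hw
    refine Eventually.of_forall fun y => ?_
    have hw0 : 0 < w := by linarith [hw.1]
    rw [norm_mul, norm_mul, norm_weight_eq hw0]
    simp only [Complex.add_re, Complex.neg_re, Complex.ofReal_re, Complex.mul_re, Complex.I_re, mul_zero, Complex.ofReal_im,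
      Complex.I_im, mul_one, sub_self, add_zero]
    have hph := norm_phase_le hε (-(s₁ : ℂ) + (y : ℂ) * Complex.I)
    simp only [Complex.add_im, Complex.neg_im, Complex.ofReal_im, neg_zero, Complex.mul_im, Complex.I_re, Complex.I_im,
      Complex.ofReal_re, mul_zero, mul_one, zero_add, add_zero] at hph
    have hws : w ^ (-s₁) ≤ (2 : ℝ) ^ s₁ := by
      rw [Real.rpow_neg hw0.le, ← Real.inv_rpow hw0.le]
      exact Real.rpow_le_rpow (by positivity) (by rw [inv_le_comm₀ hw0 (by norm_num)]; linarith [hw.1]) hs₁.le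
    gcongr
  · exact ((integrable_norm_vwpKernel_mul_exp_pi m h hs₁ hnum hden h5).mul_const _)
  · refine Eventually.of_forall fun y => ?_
    have := (tendsto_weight_one (-(s₁ : ℂ) + (y : ℂ) * Complex.I)).const_mul
      ((h 0 + 2 * (-(s₁ : ℂ) + (y : ℂ) * Complex.I)) *
            (∏ j ∈ Finset.range (m + 1), Complex.Gamma (h j + (-(s₁ : ℂ) + (y : ℂ) * Complex.I))) *
            Complex.Gamma (-(-(s₁ : ℂ) + (y : ℂ) * Complex.I)) /
          (∏ j ∈ Finset.range m, Complex.Gamma (1 + h 0 - h (j + 1) + (-(s₁ : ℂ) + (y : ℂ) * Complex.I))) *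
        Complex.exp (ε * π * Complex.I * (-(s₁ : ℂ) + (y : ℂ) * Complex.I)))
    simpa only [mul_one] using this

/-- **The series side** (Tannery): `Σ_μ c_μ (−1)^μ e^{iεπμ} w^μ → Σ_μ c_μ (−1)^μ e^{iεπμ}` as `w → 1⁻`, the `F_m` terms being the
summable majorant under (5). -/
theorem tendsto_tsum_weight (m : ℕ) (h : ℕ → ℂ) (hpos : ∀ j, j ≤ m → 0 < (h j).re) (hden : ∀ j, j ≤ m → 0 < (1 + h 0 - h j).re)
    (h5 : 2 * (∑ j ∈ Finset.range m, (h (j + 1)).re) < ((m : ℝ) - 1) * (1 + (h 0).re)) (ε : ℝ) :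
    Tendsto (fun w : ℝ => ∑' μ : ℕ, (h 0 + 2 * (μ : ℂ)) *
          (∏ j ∈ Finset.range (m + 1), Complex.Gamma (h j + μ) / Complex.Gamma (1 + h 0 - h j + μ)) *
        ((-1 : ℂ) ^ μ * Complex.exp (ε * π * Complex.I * μ) * (w : ℂ) ^ μ)) (𝓝[<] 1)
      (𝓝 (∑' μ : ℕ, (h 0 + 2 * (μ : ℂ)) *
          (∏ j ∈ Finset.range (m + 1), Complex.Gamma (h j + μ) / Complex.Gamma (1 + h 0 - h j + μ)) *
        ((-1 : ℂ) ^ μ * Complex.exp (ε * π * Complex.I * μ)))) := by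
  have hIoo : Ioo (0 : ℝ) 1 ∈ 𝓝[<] (1 : ℝ) := Ioo_mem_nhdsLT (by norm_num)
  refine tendsto_tsum_of_dominated_convergence (summable_vwpTerm m h hpos hden h5).norm (fun μ => ?_) ?_
  · have hw : Tendsto (fun w : ℝ => (w : ℂ) ^ μ) (𝓝[<] 1) (𝓝 1) := by
      have hc : Continuous (fun w : ℝ => (w : ℂ) ^ μ) := by fun_prop
      have := hc.tendsto 1
      simp only [Complex.ofReal_one, one_pow] at this
      exact this.mono_left nhdsWithin_le_nhds
    have := hw.const_mul ((h 0 + 2 * (μ : ℂ)) *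
          (∏ j ∈ Finset.range (m + 1), Complex.Gamma (h j + μ) / Complex.Gamma (1 + h 0 - h j + μ)) *
        ((-1 : ℂ) ^ μ * Complex.exp (ε * π * Complex.I * μ)))
    simp only [mul_one] at this
    refine this.congr fun w => ?_
    ring
  · filter_upwards [hIoo] with w hw
    intro μ
    set C : ℂ := (h 0 + 2 * (μ : ℂ)) *
      ∏ j ∈ Finset.range (m + 1), Complex.Gamma (h j + μ) / Complex.Gamma (1 + h 0 - h j + μ) with hC
    clear_value C
    have h1 : ‖(-1 : ℂ) ^ μ‖ = 1 := by rw [norm_pow, norm_neg, norm_one, one_pow]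
    have h2 : ‖(-1 : ℂ) ^ ((m + 1) * μ)‖ = 1 := by rw [norm_pow, norm_neg, norm_one, one_pow]
    have h3 : ‖(w : ℂ) ^ μ‖ = w ^ μ := by rw [norm_pow, Complex.norm_real, Real.norm_eq_abs, abs_of_pos hw.1]
    calc ‖C * ((-1 : ℂ) ^ μ * Complex.exp (ε * π * Complex.I * μ) * (w : ℂ) ^ μ)‖ = ‖C‖ * w ^ μ := by
          rw [norm_mul, norm_mul, norm_mul, norm_phase_nat, h1, h3]; ring
      _ ≤ ‖C‖ := mul_le_of_le_one_right (norm_nonneg _) (pow_le_one₀ hw.1.le hw.2.le)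
      _ = ‖C * (-1 : ℂ) ^ ((m + 1) * μ)‖ := by rw [norm_mul, h2, mul_one]

/-! ### 2. The Barnes-integral representation -/

/-- **The Barnes integral of the very-well-poised kernel, any phase `|ε| ≤ 1`** [Nesterenko 2003, Lemma 3; Zudilin math/0206177,
§2]: for `h : ℕ → ℂ`, `0 < s₁ < Re h_j` (`j ≤ m`), `s₁ < Re(1+h₀−h_{j+1})` (`j < m`) and (5) `2 Σ_{j=1}^m Re h_j < (m−1)(1 + Re h₀)`,
`(1/2π) ∫ V(−s₁+iy) e^{iεπ(−s₁+iy)} dy = Σ_μ (h₀+2μ) ∏_{j≤m} Γ(h_j+μ)/Γ(1+h₀−h_j+μ) · (−1)^μ e^{iεπμ}`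
(the residues of `Γ(−s)` at `s = μ` being `−(−1)^μ/μ!`). -/
theorem barnes_eq_tsum (m : ℕ) (h : ℕ → ℂ) (hs₁ : 0 < s₁) (hnum : ∀ j, j ≤ m → s₁ < (h j).re)
    (hden : ∀ j, j < m → s₁ < (1 + h 0 - h (j + 1)).re)
    (h5 : 2 * (∑ j ∈ Finset.range m, (h (j + 1)).re) < ((m : ℝ) - 1) * (1 + (h 0).re)) (hε : |ε| ≤ 1) :
    (1 / (2 * π) : ℂ) * ∫ y : ℝ,
        (h 0 + 2 * (-(s₁ : ℂ) + (y : ℂ) * Complex.I)) *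
              (∏ j ∈ Finset.range (m + 1), Complex.Gamma (h j + (-(s₁ : ℂ) + (y : ℂ) * Complex.I))) *
              Complex.Gamma (-(-(s₁ : ℂ) + (y : ℂ) * Complex.I)) /
            (∏ j ∈ Finset.range m, Complex.Gamma (1 + h 0 - h (j + 1) + (-(s₁ : ℂ) + (y : ℂ) * Complex.I))) *
          Complex.exp (ε * π * Complex.I * (-(s₁ : ℂ) + (y : ℂ) * Complex.I)) =
      ∑' μ : ℕ, (h 0 + 2 * (μ : ℂ)) *
          (∏ j ∈ Finset.range (m + 1), Complex.Gamma (h j + μ) / Complex.Gamma (1 + h 0 - h j + μ)) *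
        ((-1 : ℂ) ^ μ * Complex.exp (ε * π * Complex.I * μ)) := by
  have hpos : ∀ j, j ≤ m → 0 < (h j).re := fun j hj => lt_trans hs₁ (hnum j hj)
  have hden' := den_pos_all m h hs₁ hden
  have hA := (tendsto_integral_weight m h hs₁ hnum hden h5 hε).const_mul (1 / (2 * π) : ℂ)
  have hB := tendsto_tsum_weight m h hpos hden' h5 ε
  have hIoo : Ioo (0 : ℝ) 1 ∈ 𝓝[<] (1 : ℝ) := Ioo_mem_nhdsLT (by norm_num)
  refine tendsto_nhds_unique_of_eventuallyEq hA hB ?_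
  filter_upwards [hIoo] with w hw
  exact barnes_weighted_eq_tsum m h hs₁ hnum hden h5 hε hw.1 hw.2

/-- **The Barnes-integral representation of `F_m` with Zudilin's parity rule** [Zudilin math/0206177, (1), (5) and §2 (the integral
for `F_{k+2}` with the phase `e^{ε_k πis}`); Nesterenko 2003, Lemma 3]: under the hypotheses of `barnes_eq_tsum` and `ε = 0` with `m`
even, or `ε = ±1` with `m` odd,
`(1/2π) ∫ V(−s₁+iy) e^{iεπ(−s₁+iy)} dy = Σ_μ (h₀+2μ) ∏_{j≤m} Γ(h_j+μ)/Γ(1+h₀−h_j+μ) · (−1)^{(m+1)μ} = F_m(h₀;h₁,…,h_m)`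
— the inline very-well-poised series of `VWPSeriesSummable.summable_vwpTerm`, at COMPLEX parameters. -/
theorem barnes_eq_vwpSeries (m : ℕ) (h : ℕ → ℂ) (hs₁ : 0 < s₁) (hnum : ∀ j, j ≤ m → s₁ < (h j).re)
    (hden : ∀ j, j < m → s₁ < (1 + h 0 - h (j + 1)).re)
    (h5 : 2 * (∑ j ∈ Finset.range m, (h (j + 1)).re) < ((m : ℝ) - 1) * (1 + (h 0).re))
    (hε : (Even m ∧ ε = 0) ∨ (Odd m ∧ (ε = 1 ∨ ε = -1))) :
    (1 / (2 * π) : ℂ) * ∫ y : ℝ,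
        (h 0 + 2 * (-(s₁ : ℂ) + (y : ℂ) * Complex.I)) *
              (∏ j ∈ Finset.range (m + 1), Complex.Gamma (h j + (-(s₁ : ℂ) + (y : ℂ) * Complex.I))) *
              Complex.Gamma (-(-(s₁ : ℂ) + (y : ℂ) * Complex.I)) /
            (∏ j ∈ Finset.range m, Complex.Gamma (1 + h 0 - h (j + 1) + (-(s₁ : ℂ) + (y : ℂ) * Complex.I))) *
          Complex.exp (ε * π * Complex.I * (-(s₁ : ℂ) + (y : ℂ) * Complex.I)) =
      ∑' μ : ℕ, (h 0 + 2 * (μ : ℂ)) *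
          (∏ j ∈ Finset.range (m + 1), Complex.Gamma (h j + μ) / Complex.Gamma (1 + h 0 - h j + μ)) *
        (-1 : ℂ) ^ ((m + 1) * μ) := by
  have hε' : |ε| ≤ 1 := by
    rcases hε with ⟨-, h0⟩ | ⟨-, h1 | h1⟩
    · simp [h0]
    · simp [h1]
    · simp [h1]
  rw [barnes_eq_tsum m h hs₁ hnum hden h5 hε']
  refine tsum_congr fun μ => ?_
  rw [mul_comm ((-1 : ℂ) ^ μ), phase_parity hε μ]

end Summit.KontsevichZagierPeriods.Zeta5Search.VWPBarnesSeries

end
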